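import Summits.QuantumFields.BalabanUV.Beta.ChartConjugationDefect
import Summits.QuantumFields.BalabanUV.Beta.ChartConjugationReflection

/-!
# `BalabanUV.Beta.ChartConjugationDefectEnd` — the reflection-covariance END with the chart-conjugation DEFECT and its COMPENSATOR
# (β sub-cell, row D1 OWNER b2b-balaban-beta-an2, gen 26; K4c of RULING R-D1-g25-5 / D-K4-1 and of the slice-exchange row hSX, R-D1-g25-4)

HONEST FRAMING (cell contract, verbatim): «discharging `BetaPertH` makes Bałaban's UV stability UNCONDITIONAL — a real
constructive-QFT result; it is NOT the continuum limit and NOT the Clay problem.»  THIS MODULE mints no `Prop` fact (two `def`s of DATA: NAMES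
for the inline defects of `ChartConjugationDefect`), cites nothing as a hypothesis, instantiates NO binder of the wall and DISCHARGES NOTHING of it: it re-states an5's `hR` ENDs
(`ChartConjugationReflection.hess_refl_conj` … `ChartConjugationEnd.axisReflectionCovariant_flipK_hessKer_conj`) with the two-sided sockets
`comp K 𝕄 = idK = comp 𝕄 K` DROPPED — for an ARBITRARY spread pair `(K, 𝕄)` — at the price of the displayed chart-conjugation defect
`ChartConjugationDefect.conjDefect`, and then with the defect COMPENSATED by an extra second-order table.  Every remaining hypothesis is a
BINDER.  NOT summit progress; NOT continuum; NOT Clay.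

ABSOLUTE RULE (cell, verbatim): «No internally-minted statement may enter as a cited fact. Every hypothesis is either
kernel-proved in this package or a verbatim quotation of a PUBLISHED theorem with page reference. The manuscript(s) under
audit are NOT citable for their own disputed steps — they are the thing under adjudication; programme-internal
(2001/route/tribunal) claims are never citable.»  Every theorem below is kernel-proved from explicit, abstract hypotheses.

WHY (R-D1-g25-4 / -5).  For the (0.4)-symmetrised row-D1 literal «JsB12Sym» the one-step resolvent `G_j` is a RELATIVE inverse of the
bordered step Hessian on the range of the block-orthogonal slice projector `symEc`, which does NOT commute with the contact generators of
the reflection re-charting.  By `ChartConjugationDefect.hess_conj_defect` the assembled Hessian form then picks up the defect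
`conjDefect G 𝕄 V V′ X X′ X₂` (in commutator currency: `ChartConjugationRelativeSX.conjDefect_eq_comm`), so the sliced LETTERS ALONE obey
the printed reflection law (5.7) only UP TO that defect (§1 `hess_refl_conj_defect`, `hessKer_refl_conj_defect`).  Chart (II) of
R-D1-g25-4 carries the slice-exchange row: the second-order table of the jets is `W + W_SX`, whose reflection law has, besides the
chart-conjugation contact `conjW`, a COMPENSATOR `Wc` (the reflection contact of the slice-exchange row).  §1–§2 prove: if the compensator's
tadpole cancels the defect — the displayed binder `hcomp : ½·tadpole K (Wc …) + conjDefect K 𝕄 … = 0`, which is what the hSX binder has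
to deliver for Bałaban's objects — then the reflection law holds EXACTLY, with NO inverse relation between `K` and `𝕄` at all.

CONTENT.
* §0 NAMES for the two defects of `ChartConjugationDefect` (K4a, filed by t4-ne9-formalise-leaf-06-g33 from the owner's statement list, p247016):
  `sandwichDefect A 𝕄 X := (A ∘ conjV 𝕄 X) ∘ A + conjV A X`, **`conjDefect A 𝕄 V V′ X X′ X₂`** := K4a's inline `Δ`; `hess_conj_defect_eq`
  (K4a's `hess_conj_defect` with the defect NAMED), `conjDefect_eq_zero_of_two_sided` (K4a's `delta_of_two_sided`), and
  `traceDefect_eq_zero_of_symm` (an3-g48 (τ0): for a SYMMETRIC pair `𝕄ᵀ = 𝕄`, `Aᵀ = A` the trace defect vanishes on transpose-symmetric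
  letters; universal, no socket).
* §1 (generic fibre) `hess_refl_conj_defect` (law up to the defect, no socket), **`hess_refl_conj_compensated`**, `hessKer_refl_conj_defect`,
  `hessKer_refl_conj_compensated`, **`axisReflectionCovariant_flip_hessKer_conj_compensated`** — an5's three with `(hAM, hMA)` replaced by
  NOTHING (defect form) or by the compensator `Wc` and `hcomp` (exact form).
* §2 (packed fibre) **`axisReflectionCovariant_flipK_hessKer_conj_compensated`** — sockets (St), (Wt), (Sr-conj) VERBATIM as in an5's END,
  (Wr-conj) with the compensator added inside `refK`, plus `hcomp`; kernel side: `K` decaying, block-translation and reflection invariant;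
  `𝕄` spread; NO inverse identity.
The dressed-family instance (§3 of `ChartConjugationRelativeEnd`) for the symmetrised dressing `coDressKSymAt` follows in `RowD1JointEndSym`
once `SymmetrisedDressingKernel` is in the tree.

RELATION TO THE TREE (no duplication): `hess_conj_defect`, `conjDefect`, the contacts, `vertexOfK_reflect_conj`, `tadpole_refK_loc` /
`bubble_refK_loc` and every analytic brick are USED BY NAME.  [folklore] kernel algebra of OUR objects; discharges NOTHING of row D1;
NOT D1, NOT BetaPertH, NOT continuum, NOT Clay.
-/

open Finset
open scoped BigOperators
open Literature.MathematicalPhysics.QuantumFieldTheory.Balaban1983to89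
open Literature.MathematicalPhysics.QuantumFieldTheory.Balaban1983to89.Beta
open B12Sec2to5 (l1 l1_nonneg)
open ExpKernelCalculus (MKer Decays BiLoc comp tr bubble tadpole hess hessKer hess_eq_hessKer BlockCovariant VertexFamily VertexFamily₂)
open PolarizationSign (axisReflect axisReflect_apply reflSign AxisReflectionCovariant)
open KernelReflection (LegMap refK refK_apply bondRefl bondRefl_sub comp_refK tr_refK tadpole_smul bubble_smul_left bubble_smul_right)
open OneStepResolventKernel (Fib wsum LocStencil JetData)
open OneStepKernelFamily (KInvStep colH vertexOfK vertexFamily_vertexOfK' TstepOf TbalOf flipK)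
open ResolventReflection (bref bref_eq_bondRefl Φ vertexOfK_translate_block)
open HessKerSchurResolvent (idK)
open Summit.QuantumFields.BalabanUV.Beta.TameKernelCalculus
open Summit.QuantumFields.BalabanUV.Beta.ChartConjugationRelative (spr_comp)
open Summit.QuantumFields.BalabanUV.Beta.ChartConjugation
open Summit.QuantumFields.BalabanUV.Beta.ChartConjugationReflection
open Summit.QuantumFields.BalabanUV.Beta.ChartConjugationDefect

namespace Summit.QuantumFields.BalabanUV.Beta.ChartConjugationDefectEnd

noncomputable section

/-! ## §0 Names for the two defects of `ChartConjugationDefect`; the symmetric-pair vanishing of the trace defect -/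

section Names0

variable {D : ℕ} {F : Type*} [Fintype F]

variable {A M : MKer D F}

/-- **THE SANDWICH DEFECT** of the pair `(A, 𝕄)` at a generator `X` (DATA, a kernel): `(A ∘ conjV 𝕄 X) ∘ A + conjV A X`
(`= A∘(𝕄X − X𝕄)∘A + (AX − XA)`) — the inline `S_X` of `ChartConjugationDefect`; `0` for two-sided sockets
(`ChartConjugationDefect.sandwichDefect_of_two_sided`). -/
def sandwichDefect (A M X : MKer D F) : MKer D F := comp (comp A (conjV M X)) A + conjV A X

/-- **THE CHART-CONJUGATION DEFECT** of the pair `(A, 𝕄)` at the letters `(V, V′, X, X′, X₂)` (DATA, a real number): the inline `Δ` of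
`ChartConjugationDefect.hess_conj_defect` — `½·(tr((X′∘X)∘conjV 𝕄 A) − tr(X₂∘conjV 𝕄 A)) − ½·(tr(S_X∘V′) + tr(S_{X′}∘V) + tr(S_X∘conjV 𝕄 X′))`. -/
def conjDefect (A M V Vp X Xp X₂ : MKer D F) : ℝ :=
  (1 / 2 : ℝ) * (tr (comp (comp Xp X) (conjV M A)) - tr (comp X₂ (conjV M A)))
    - (1 / 2 : ℝ) * (tr (comp (sandwichDefect A M X) Vp) + tr (comp (sandwichDefect A M Xp) V)
        + tr (comp (sandwichDefect A M X) (conjV M Xp)))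

/-- `sandwichDefect` unfolds to K4a's inline expression. -/
theorem sandwichDefect_eq (A M X : MKer D F) : sandwichDefect A M X = comp (comp A (conjV M X)) A + conjV A X := rfl

/-- The sandwich defect of a localised generator is localised (K4a's `loc_sandwichDefect`). -/
theorem loc_sandwichDefect' (hA : Spr A) (hM : Spr M) {X : MKer D F} (hX : Loc X) : Loc (sandwichDefect A M X) :=
  loc_sandwichDefect hA hM hX

/-- **K4a's `hess_conj_defect` WITH THE DEFECT NAMED**:
`½·tadpole A (W + conjW 𝕄 V V′ X X′ X₂) − ½·bubble A (V + conjV 𝕄 X) (V′ + conjV 𝕄 X′) = ½·tadpole A W − ½·bubble A V V′ + conjDefect A 𝕄 V V′ X X′ X₂`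
(spread `A`, `𝕄`, NO relation between them; localised letters). -/
theorem hess_conj_defect_eq (hA : Spr A) (hM : Spr M) {V Vp W X Xp X₂ : MKer D F}
    (hV : Loc V) (hVp : Loc Vp) (hW : Loc W) (hX : Loc X) (hXp : Loc Xp) (hX₂ : Loc X₂) :
    (1 / 2 : ℝ) * tadpole A (W + conjW M V Vp X Xp X₂) - (1 / 2 : ℝ) * bubble A (V + conjV M X) (Vp + conjV M Xp)
      = (1 / 2 : ℝ) * tadpole A W - (1 / 2 : ℝ) * bubble A V Vp + conjDefect A M V Vp X Xp X₂ :=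
  hess_conj_defect hA hM hV hVp hW hX hXp hX₂

/-- With two-sided sockets the chart-conjugation defect vanishes (K4a's `delta_of_two_sided`). -/
theorem conjDefect_eq_zero_of_two_sided [DecidableEq F] (hA : Spr A) (hM : Spr M) (hAM : comp A M = idK) (hMA : comp M A = idK)
    {V Vp X Xp X₂ : MKer D F} (hX : Loc X) (hXp : Loc Xp) : conjDefect A M V Vp X Xp X₂ = 0 :=
  delta_of_two_sided (V := V) (Vp := Vp) (X₂ := X₂) hA hM hAM hMA hX hXp

/-- **THE TRACE DEFECT VANISHES ON SYMMETRIC LETTERS FOR A SYMMETRIC PAIR** (an3-g48 (τ0); universal, no socket): if `𝕄ᵀ = 𝕄` and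
`Aᵀ = A` then `tr(Y ∘ conjV 𝕄 A) = 0` for every localised `Y` with `Yᵀ = Y` (`tr(Y∘𝕄A) = tr((Y∘𝕄A)ᵀ) = tr(A𝕄∘Y) = tr(Y∘A𝕄)`).  Consequence:
in `conjDefect` the `X′X`- and `X₂`-terms drop whenever those letters are transpose-symmetric (the packed instance uses the `sgnK`-signed
symmetry of `BorderedHessianSymmetry` and lands with the wiring). -/
theorem traceDefect_eq_zero_of_symm (hA : Spr A) (hM : Spr M) (hMt : trK M = M) (hAt : trK A = A) {Y : MKer D F} (hY : Loc Y)
    (hYt : trK Y = Y) : tr (comp Y (conjV M A)) = 0 := by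
  have hAM : Tame (comp A M) := (spr_comp hA hM).tame
  have hMA : Tame (comp M A) := (spr_comp hM hA).tame
  have h0 : comp Y (conjV M A) = comp Y (comp M A) - comp Y (comp A M) := by
    unfold conjV
    rw [comp_sub_right_tame hY.tame hMA hAM]
  have h1 : tr (comp Y (comp M A)) = tr (comp Y (comp A M)) :=
    calc tr (comp Y (comp M A)) = tr (trK (comp Y (comp M A))) := (tr_trK _).symm
      _ = tr (comp (comp (trK A) (trK M)) (trK Y)) := by rw [trK_comp, trK_comp]
      _ = tr (comp (comp A M) Y) := by rw [hAt, hMt, hYt]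
      _ = tr (comp Y (comp A M)) := (tr_comp_comm_loc hY hAM).symm
  rw [h0, tr_sub_loc (hY.comp_spr (spr_comp hM hA)) (hY.comp_spr (spr_comp hA hM)), h1, sub_self]

end Names0

/-! ## §1 Covariance of the resolvent Hessian under a symmetry with conjugated vertex laws — defect and compensator, no socket -/

section General

variable {D : ℕ} {F : Type*} [Fintype F]

/-- **COVARIANCE OF THE RESOLVENT HESSIAN UP TO THE CHART-CONJUGATION DEFECT — NO SOCKET** (`ChartConjugationReflection.hess_refl_conj`
with the inverse identities DROPPED).  If `A` is relabelling-invariant, `𝕄` is any spread kernel, and the vertex families at the image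
bonds are the relabelled ones PLUS the chart-conjugation contacts (Sr-conj)/(Wr-conj), then
`hess μ (ρ μ y) ν (ρ ν y′) = σ μ σ ν · (hess μ y ν y′ + conjDefect A 𝕄 (V μ y) (V ν y′) (X μ y) (X ν y′) (X₂ μ y ν y′))`. -/
theorem hess_refl_conj_defect (Φ : LegMap D F) {A M : MKer D F} {V : Fin D → (Fin D → ℤ) → MKer D F}
    {W : Fin D → (Fin D → ℤ) → Fin D → (Fin D → ℤ) → MKer D F} (hA : Spr A) (hM : Spr M) (hAr : refK Φ A = A)
    (hV : ∀ μ y, Loc (V μ y)) (hW : ∀ μ y ν y', Loc (W μ y ν y'))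
    (ρ : Fin D → (Fin D → ℤ) → (Fin D → ℤ)) (σ : Fin D → ℝ) {X : Fin D → (Fin D → ℤ) → MKer D F}
    {X₂ : Fin D → (Fin D → ℤ) → Fin D → (Fin D → ℤ) → MKer D F} (hX : ∀ μ y, Loc (X μ y)) (hX₂ : ∀ μ y ν y', Loc (X₂ μ y ν y'))
    (hVr : ∀ μ y, V μ (ρ μ y) = σ μ • refK Φ (V μ y + conjV M (X μ y)))
    (hWr : ∀ μ y ν y', W μ (ρ μ y) ν (ρ ν y') =
      (σ μ * σ ν) • refK Φ (W μ y ν y' + conjW M (V μ y) (V ν y') (X μ y) (X ν y') (X₂ μ y ν y')))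
    (μ : Fin D) (y : Fin D → ℤ) (ν : Fin D) (y' : Fin D → ℤ) :
    hess A V W μ (ρ μ y) ν (ρ ν y') =
      σ μ * σ ν * (hess A V W μ y ν y' + conjDefect A M (V μ y) (V ν y') (X μ y) (X ν y') (X₂ μ y ν y')) := by
  have key := hess_conj_defect_eq hA hM (hV μ y) (hV ν y') (hW μ y ν y') (hX μ y) (hX ν y') (hX₂ μ y ν y')
  have hW' : Loc (W μ y ν y' + conjW M (V μ y) (V ν y') (X μ y) (X ν y') (X₂ μ y ν y')) :=
    (hW μ y ν y').add (loc_conjW hM (hV μ y) (hV ν y') (hX μ y) (hX ν y') (hX₂ μ y ν y'))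
  have hV₁ : Loc (V μ y + conjV M (X μ y)) := (hV μ y).add (loc_conjV hM (hX μ y))
  have hV₂ : Loc (V ν y' + conjV M (X ν y')) := (hV ν y').add (loc_conjV hM (hX ν y'))
  unfold ExpKernelCalculus.hess
  rw [hWr, hVr, hVr, tadpole_smul, bubble_smul_left, bubble_smul_right]
  conv_lhs => rw [← hAr]
  rw [tadpole_refK_loc Φ hA hW', bubble_refK_loc Φ hA hV₁ hV₂]
  linear_combination (σ μ * σ ν) * key

/-- **COVARIANCE OF THE RESOLVENT HESSIAN, CONJUGATED VERTEX LAWS WITH A COMPENSATOR — NO SOCKET.**  As `hess_refl_conj_defect`, but the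
second-order law carries an extra localised table `Wc μ y ν y′` inside `refK` ((Wr-conj-c)), whose tadpole cancels the defect:
`½·tadpole A (Wc μ y ν y′) + conjDefect A 𝕄 (V μ y) (V ν y′) (X μ y) (X ν y′) (X₂ μ y ν y′) = 0` (BINDER `hcomp`).  Then
`hess μ (ρ μ y) ν (ρ ν y′) = σ μ σ ν · hess μ y ν y′` EXACTLY — with no inverse relation between `A` and `𝕄`. -/
theorem hess_refl_conj_compensated (Φ : LegMap D F) {A M : MKer D F} {V : Fin D → (Fin D → ℤ) → MKer D F}
    {W : Fin D → (Fin D → ℤ) → Fin D → (Fin D → ℤ) → MKer D F} (hA : Spr A) (hM : Spr M) (hAr : refK Φ A = A)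
    (hV : ∀ μ y, Loc (V μ y)) (hW : ∀ μ y ν y', Loc (W μ y ν y'))
    (ρ : Fin D → (Fin D → ℤ) → (Fin D → ℤ)) (σ : Fin D → ℝ) {X : Fin D → (Fin D → ℤ) → MKer D F}
    {X₂ Wc : Fin D → (Fin D → ℤ) → Fin D → (Fin D → ℤ) → MKer D F} (hX : ∀ μ y, Loc (X μ y))
    (hX₂ : ∀ μ y ν y', Loc (X₂ μ y ν y')) (hWc : ∀ μ y ν y', Loc (Wc μ y ν y'))
    (hVr : ∀ μ y, V μ (ρ μ y) = σ μ • refK Φ (V μ y + conjV M (X μ y)))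
    (hWr : ∀ μ y ν y', W μ (ρ μ y) ν (ρ ν y') =
      (σ μ * σ ν) • refK Φ (W μ y ν y' + conjW M (V μ y) (V ν y') (X μ y) (X ν y') (X₂ μ y ν y') + Wc μ y ν y'))
    (hcomp : ∀ μ y ν y', (1 / 2 : ℝ) * tadpole A (Wc μ y ν y')
      + conjDefect A M (V μ y) (V ν y') (X μ y) (X ν y') (X₂ μ y ν y') = 0)
    (μ : Fin D) (y : Fin D → ℤ) (ν : Fin D) (y' : Fin D → ℤ) :
    hess A V W μ (ρ μ y) ν (ρ ν y') = σ μ * σ ν * hess A V W μ y ν y' := by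
  have key := hess_conj_defect_eq hA hM (hV μ y) (hV ν y') (hW μ y ν y') (hX μ y) (hX ν y') (hX₂ μ y ν y')
  have hc := hcomp μ y ν y'
  have hW' : Loc (W μ y ν y' + conjW M (V μ y) (V ν y') (X μ y) (X ν y') (X₂ μ y ν y')) :=
    (hW μ y ν y').add (loc_conjW hM (hV μ y) (hV ν y') (hX μ y) (hX ν y') (hX₂ μ y ν y'))
  have hV₁ : Loc (V μ y + conjV M (X μ y)) := (hV μ y).add (loc_conjV hM (hX μ y))
  have hV₂ : Loc (V ν y' + conjV M (X ν y')) := (hV ν y').add (loc_conjV hM (hX ν y'))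
  unfold ExpKernelCalculus.hess
  rw [hWr, hVr, hVr, tadpole_smul, bubble_smul_left, bubble_smul_right]
  conv_lhs => rw [← hAr]
  rw [tadpole_refK_loc Φ hA (hW'.add (hWc μ y ν y')), bubble_refK_loc Φ hA hV₁ hV₂, tadpole_add hA hW' (hWc μ y ν y')]
  linear_combination (σ μ * σ ν) * key + (σ μ * σ ν) * hc

open B6BondElimination (unitVec unitVec_apply) in
/-- **THE DIFFERENCE-VARIABLE LAW UP TO THE DEFECT — NO SOCKET** (`ChartConjugationReflection.hessKer_refl_conj` twin): the sliced letters
ALONE obey the printed reflection law up to `conjDefect A 𝕄 (V μ 0) (V ν z) (X μ 0) (X ν z) (X₂ μ 0 ν z)`. -/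
theorem hessKer_refl_conj_defect (Φ : LegMap D F) {A M : MKer D F} {V : Fin D → (Fin D → ℤ) → MKer D F}
    {W : Fin D → (Fin D → ℤ) → Fin D → (Fin D → ℤ) → MKer D F} {N : ℕ} (hA : Spr A) (hM : Spr M)
    (hcov : BlockCovariant A V W N) (hAr : refK Φ A = A) (hV : ∀ μ y, Loc (V μ y))
    (hW : ∀ μ y ν y', Loc (W μ y ν y')) (α : Fin D) (c : ℤ) {X : Fin D → (Fin D → ℤ) → MKer D F}
    {X₂ : Fin D → (Fin D → ℤ) → Fin D → (Fin D → ℤ) → MKer D F} (hX : ∀ μ y, Loc (X μ y)) (hX₂ : ∀ μ y ν y', Loc (X₂ μ y ν y'))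
    (hVr : ∀ μ y, V μ (bondRefl α c μ y) = reflSign α μ • refK Φ (V μ y + conjV M (X μ y)))
    (hWr : ∀ μ y ν y', W μ (bondRefl α c μ y) ν (bondRefl α c ν y') =
      (reflSign α μ * reflSign α ν) • refK Φ (W μ y ν y' + conjW M (V μ y) (V ν y') (X μ y) (X ν y') (X₂ μ y ν y')))
    (μ ν : Fin D) (z : Fin D → ℤ) :
    hessKer A V W μ ν (axisReflect α z + (if μ = α then unitVec α else 0) - (if ν = α then unitVec α else 0))
      = reflSign α μ * reflSign α ν *
          (hessKer A V W μ ν z + conjDefect A M (V μ 0) (V ν z) (X μ 0) (X ν z) (X₂ μ 0 ν z)) := by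
  have h := hess_refl_conj_defect Φ hA hM hAr hV hW (bondRefl α c) (reflSign α) hX hX₂ hVr hWr μ 0 ν z
  rw [hess_eq_hessKer hcov, hess_eq_hessKer hcov, sub_zero, bondRefl_sub, sub_zero] at h
  exact h

open B6BondElimination (unitVec unitVec_apply) in
/-- **THE DIFFERENCE-VARIABLE LAW WITH A COMPENSATOR — NO SOCKET** (`ChartConjugationReflection.hessKer_refl_conj` twin, exact). -/
theorem hessKer_refl_conj_compensated (Φ : LegMap D F) {A M : MKer D F} {V : Fin D → (Fin D → ℤ) → MKer D F}
    {W : Fin D → (Fin D → ℤ) → Fin D → (Fin D → ℤ) → MKer D F} {N : ℕ} (hA : Spr A) (hM : Spr M)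
    (hcov : BlockCovariant A V W N) (hAr : refK Φ A = A) (hV : ∀ μ y, Loc (V μ y))
    (hW : ∀ μ y ν y', Loc (W μ y ν y')) (α : Fin D) (c : ℤ) {X : Fin D → (Fin D → ℤ) → MKer D F}
    {X₂ Wc : Fin D → (Fin D → ℤ) → Fin D → (Fin D → ℤ) → MKer D F} (hX : ∀ μ y, Loc (X μ y))
    (hX₂ : ∀ μ y ν y', Loc (X₂ μ y ν y')) (hWc : ∀ μ y ν y', Loc (Wc μ y ν y'))
    (hVr : ∀ μ y, V μ (bondRefl α c μ y) = reflSign α μ • refK Φ (V μ y + conjV M (X μ y)))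
    (hWr : ∀ μ y ν y', W μ (bondRefl α c μ y) ν (bondRefl α c ν y') =
      (reflSign α μ * reflSign α ν) • refK Φ (W μ y ν y' + conjW M (V μ y) (V ν y') (X μ y) (X ν y') (X₂ μ y ν y') + Wc μ y ν y'))
    (hcomp : ∀ μ y ν y', (1 / 2 : ℝ) * tadpole A (Wc μ y ν y')
      + conjDefect A M (V μ y) (V ν y') (X μ y) (X ν y') (X₂ μ y ν y') = 0)
    (μ ν : Fin D) (z : Fin D → ℤ) :
    hessKer A V W μ ν (axisReflect α z + (if μ = α then unitVec α else 0) - (if ν = α then unitVec α else 0))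
      = reflSign α μ * reflSign α ν * hessKer A V W μ ν z := by
  have h := hess_refl_conj_compensated Φ hA hM hAr hV hW (bondRefl α c) (reflSign α) hX hX₂ hWc hVr hWr hcomp μ 0 ν z
  rw [hess_eq_hessKer hcov, hess_eq_hessKer hcov, sub_zero, bondRefl_sub, sub_zero] at h
  exact h

open B6BondElimination (unitVec unitVec_apply) in
/-- **`AxisReflectionCovariant` OF THE FLIPPED KERNEL FROM THE CONJUGATED VERTEX LAWS WITH COMPENSATORS — NO SOCKET**
(`ChartConjugationReflection.axisReflectionCovariant_flip_hessKer_conj` twin): per axis, a leg map fixing `A`, an offset, localised contact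
families `X`, `X₂`, a localised compensator `Wc` with (Sr-conj), (Wr-conj-c) and `hcomp`. -/
theorem axisReflectionCovariant_flip_hessKer_conj_compensated {A M : MKer D F} {V : Fin D → (Fin D → ℤ) → MKer D F}
    {W : Fin D → (Fin D → ℤ) → Fin D → (Fin D → ℤ) → MKer D F} {N : ℕ} (hA : Spr A) (hM : Spr M)
    (hcov : BlockCovariant A V W N) (hV : ∀ μ y, Loc (V μ y)) (hW : ∀ μ y ν y', Loc (W μ y ν y'))
    (hAr : ∀ α : Fin D, ∃ Φα : LegMap D F, refK Φα A = A ∧ ∃ (c : ℤ) (X : Fin D → (Fin D → ℤ) → MKer D F)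
      (X₂ Wc : Fin D → (Fin D → ℤ) → Fin D → (Fin D → ℤ) → MKer D F),
      (∀ μ y, Loc (X μ y)) ∧ (∀ μ y ν y', Loc (X₂ μ y ν y')) ∧ (∀ μ y ν y', Loc (Wc μ y ν y')) ∧
      (∀ μ y, V μ (bondRefl α c μ y) = reflSign α μ • refK Φα (V μ y + conjV M (X μ y))) ∧
      (∀ μ y ν y', W μ (bondRefl α c μ y) ν (bondRefl α c ν y') =
        (reflSign α μ * reflSign α ν) • refK Φα (W μ y ν y' + conjW M (V μ y) (V ν y') (X μ y) (X ν y') (X₂ μ y ν y')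
          + Wc μ y ν y')) ∧
      (∀ μ y ν y', (1 / 2 : ℝ) * tadpole A (Wc μ y ν y')
        + conjDefect A M (V μ y) (V ν y') (X μ y) (X ν y') (X₂ μ y ν y') = 0)) :
    AxisReflectionCovariant (fun μ ν z => hessKer A V W μ ν (-z)) := by
  intro α μ ν z
  obtain ⟨Φα, hA', c, X, X₂, Wc, hX, hX₂, hWc, hVr, hWr, hcomp⟩ := hAr α
  have h := hessKer_refl_conj_compensated Φα hA hM hcov hA' hV hW α c hX hX₂ hWc hVr hWr hcomp μ ν (-z)
  have e : -(axisReflect α z - (if μ = α then unitVec α else 0) + (if ν = α then unitVec α else 0))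
      = axisReflect α (-z) + (if μ = α then unitVec α else 0) - (if ν = α then unitVec α else 0) := by
    funext i
    simp only [Pi.neg_apply, Pi.sub_apply, Pi.add_apply, axisReflect_apply]
    by_cases hi : i = α <;> by_cases hμ : μ = α <;> by_cases hν : ν = α <;> simp [hi, hμ, hν, unitVec_apply] <;> ring
  show hessKer A V W μ ν (-(axisReflect α z - (if μ = α then unitVec α else 0) + (if ν = α then unitVec α else 0)))
    = reflSign α μ * reflSign α ν * hessKer A V W μ ν (-z)
  rw [e]
  exact h

end General

/-! ## §2 The packed level: the `hR` END with compensators, no socket -/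

section Packed

variable {d N : ℕ}

/-- **THE TYPED REFLECTION LAW OF A RESOLVENT HESSIAN KERNEL FROM CONJUGATED JET COVARIANCE WITH COMPENSATORS — NO SOCKET.**
`ChartConjugationEnd.axisReflectionCovariant_flipK_hessKer_conj` with the inverse identities `comp K 𝕄 = idK`, `comp 𝕄 K = idK` DROPPED
(`𝕄` any spread kernel), the second-order law (Wr-conj) carrying a localised COMPENSATOR family `Wc α μ y ν y′` inside `refK`, and the
cancellation binder `hcomp : ½·tadpole K (Wc α μ y ν y′) + conjDefect K 𝕄 (V μ y) (V ν y′) (X_α μ y) (X_α ν y′) (X₂ α μ y ν y′) = 0` with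
`V := vertexOfK K N J.S`, `X_α := vertexOfK K N (C α)`; the jet laws (St), (Wt), (Sr-conj) VERBATIM.  All laws are HYPOTHESES, never facts.
For the row-D1 literal «JsB12Sym»: `Wc` is the reflection contact of the slice-exchange row carried in chart (II) (R-D1-g25-4), and `hcomp`
is what the hSX binder delivers. -/
theorem axisReflectionCovariant_flipK_hessKer_conj_compensated {K M : MKer (d + 1) (Fib d)}
    (hKd : ∃ δ C : ℝ, 0 < δ ∧ 0 ≤ C ∧ Decays K C δ) (hKs : ∀ t : Fin (d + 1) → ℤ, ExpKernelCalculus.shiftK (-((N : ℤ) • t)) K = K)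
    (hKr : ∀ α : Fin (d + 1), refK (Φ N α) K = K) (hM : Spr M) (J : JetData d N)
    (hSt : ∀ (κ' : Fin (d + 1)) (u t : Fin (d + 1) → ℤ), J.S κ' (u + (N : ℤ) • t) = ExpKernelCalculus.shiftK (-((N : ℤ) • t)) (J.S κ' u))
    (hWt : ∀ (μ : Fin (d + 1)) (y : Fin (d + 1) → ℤ) (ν : Fin (d + 1)) (y' t : Fin (d + 1) → ℤ),
      J.W μ (y + t) ν (y' + t) = ExpKernelCalculus.shiftK (-((N : ℤ) • t)) (J.W μ y ν y'))
    (C : Fin (d + 1) → Fin (d + 1) → (Fin (d + 1) → ℤ) → MKer (d + 1) (Fib d)) {Cc δc : ℝ} (hC : ∀ α, LocStencil (C α) Cc δc)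
    (hδc : 0 < δc) (X₂ Wc : Fin (d + 1) → Fin (d + 1) → (Fin (d + 1) → ℤ) → Fin (d + 1) → (Fin (d + 1) → ℤ) → MKer (d + 1) (Fib d))
    (hX₂ : ∀ α μ y ν y', Loc (X₂ α μ y ν y')) (hWc : ∀ α μ y ν y', Loc (Wc α μ y ν y'))
    (hSrC : ∀ (α κ' : Fin (d + 1)) (u : Fin (d + 1) → ℤ),
      J.S κ' (bref α κ' u) = reflSign α κ' • refK (Φ N α) (J.S κ' u + conjV M (C α κ' u)))
    (hWrC : ∀ (α μ : Fin (d + 1)) (y : Fin (d + 1) → ℤ) (ν : Fin (d + 1)) (y' : Fin (d + 1) → ℤ),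
      J.W μ (bref α μ y) ν (bref α ν y') = (reflSign α μ * reflSign α ν) • refK (Φ N α) (J.W μ y ν y' +
        conjW M (vertexOfK K N J.S μ y) (vertexOfK K N J.S ν y') (vertexOfK K N (C α) μ y) (vertexOfK K N (C α) ν y')
          (X₂ α μ y ν y') + Wc α μ y ν y'))
    (hcomp : ∀ (α μ : Fin (d + 1)) (y : Fin (d + 1) → ℤ) (ν : Fin (d + 1)) (y' : Fin (d + 1) → ℤ),
      (1 / 2 : ℝ) * tadpole K (Wc α μ y ν y') + conjDefect K M (vertexOfK K N J.S μ y) (vertexOfK K N J.S ν y')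
        (vertexOfK K N (C α) μ y) (vertexOfK K N (C α) ν y') (X₂ α μ y ν y') = 0) :
    AxisReflectionCovariant (flipK (hessKer K (vertexOfK K N J.S) J.W)) := by
  obtain ⟨Cv, δv, hδv, hV⟩ := vertexFamily_vertexOfK' (N := N) hKd J.loc J.δ_pos
  have hKspr : Spr K := by obtain ⟨δK, CK, hδK, _, hK⟩ := hKd; exact ⟨CK, δK, hδK, hK⟩
  have hVl : ∀ μ y, Loc (vertexOfK K N J.S μ y) := fun μ y => ⟨_, _, Cv, δv, hδv, hV μ y⟩
  have hWl : ∀ μ y ν y', Loc (J.W μ y ν y') := fun μ y ν y' => ⟨_, _, J.Cw, J.δ, J.δ_pos, J.loc₂ μ y ν y'⟩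
  have hcov : BlockCovariant K (vertexOfK K N J.S) J.W N := ⟨hKs, vertexOfK_translate_block hKs hSt, hWt⟩
  refine axisReflectionCovariant_flip_hessKer_conj_compensated hKspr hM hcov hVl hWl fun α => ⟨Φ N α, hKr α, 1, vertexOfK K N (C α),
    X₂ α, Wc α, fun μ y => ?_, hX₂ α, hWc α, fun μ y => ?_, fun μ y ν y' => ?_, hcomp α⟩
  · obtain ⟨Cx, δx, hδx, hXv⟩ := vertexFamily_vertexOfK' (N := N) hKd (hC α) hδc
    exact ⟨_, _, Cx, δx, hδx, hXv μ y⟩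
  · rw [← bref_eq_bondRefl]
    exact vertexOfK_reflect_conj (hKr α) hKd hM J.loc J.δ_pos (hC α) hδc (hSrC α) μ y
  · rw [← bref_eq_bondRefl, ← bref_eq_bondRefl]
    exact hWrC α μ y ν y'

end Packed

end

end Summit.QuantumFields.BalabanUV.Beta.ChartConjugationDefectEnd
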